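import Summits.BirchSwinnertonDyer.Rank1Residual.Supersingular.X6KimTamDefectShape
import Summits.BirchSwinnertonDyer.Rank1Residual.Supersingular.KuriharaTwistRecordLevelKLValues
import HarnessLib

/-!
# N4 TAM-DEFECT shapes in the cell's STANDARD CURRENCY: the depth-`k` Kurihara datum `hδ` replaced by a LANDED `CertifiedK`
# row + its `validHasseK` rounding certificate + the engine's twisted-`L`-value ENCLOSURE `hballL`

Cell `b2b-bsdres`, supersingular family, prover A = unit `b2b-bsdres-x10b` (gen 13; N4 class lead).  Topic file; namespace
`Summit.BirchSwinnertonDyer.Rank1Residual.Supersingular`.  THEOREMS ONLY: `X6KimTamDefectShape.lean` (this gen) ∘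
`CertifiedK.kuriharaNumber_ne_zero_of_LValueBall` (`KuriharaTwistRecordLevelKLValues.lean`, this gen); no named fact, no
definition, nothing asserted about any curve, nothing booked; X6 stays CONSTRUCTION-SHAPED (RESIDUAL-MAP §I N4).

HONEST FRAMING (run/shared/lean/b2b/bsd-rank1-residual/, verbatim in every file): the goal of the
cell is to DELETE the COMBINATION-SHAPED residual classes of the Birch–Swinnerton-Dyer formula for
ALL analytic-rank `≤ 1` elliptic curves over `ℚ` — "full BSD formula for every rank `≤ 1` curve in
class `C`" assembled STRICTLY from published theorems — so that the rank-`≤ 1` remainder becomes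
exactly the CONSTRUCTION-SHAPED classes, which are TYPED (missing-input `Prop`s), NOT attempted.
This is not "finishing BSD".

* §1 `X6RankZero.bsdp_of_kimLower_of_prop48_of_certifiedK_of_LValueBall` — class form (`ClassX6 W r.p`, `5 ≤ r.p`, `r_an = 0`;
  Kim 2026 Thm 1.8 (6) lower half at depth `r.k ≤ ord_p ∏c + 1` + Perrin-Riou Prop 4.8 upper half, both PUBLISHED; `D`, `p ∤ c_D`,
  period transfer; cyclic level `r.n ∈ 𝒩_k`; the `CertifiedK` row `r`, a `RoundingCertifiedHasseK r.k` row `c` matching it, surjective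
  `ψ`, `hballL`) ⟹ `BSDp W r.p`.
* §2 `X6RankZero.bsdp_of_kimLower_of_prop48_of_ainvs_of_certifiedK_of_LValueBall` — the literal-equation RECORD SHAPE at a two-prime
  level (minimality instance, `classX6_of_intModel`, depth-`k` Kolyvagin primes from counts, CYCLICITY hypotheses in the literal-model
  form of `CyclicityLadder`, everything else as §1), all in terms of the record's own `r.p`, `r.k`, `r.n`.

References: [Kim2022StructureSelmer] Thm. 1.9 (6), §1.2.2, §1.4.3, §1.5.1–1.5.3; [PerrinRiou2003] Prop. 4.8; [MazurTateTeitelbaum1986Invent]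
§I.8; [CremonaAlgorithms1997] §2.8; [Serre1972] Prop. 21; [Miller2011LMS] Def. 1.1.
-/

set_option autoImplicit false

noncomputable section

open scoped Classical MatrixGroups ModularForm

open CongruenceSubgroup WeierstrassCurve Literature.NumberTheory.EllipticCurves
  Literature.NumberTheory.EllipticCurves.ModularForms
  Literature.NumberTheory.EllipticCurves.Rank1Residual
  Literature.NumberTheory.EllipticCurves.Rank1Residual.Typed
  Literature.NumberTheory.EllipticCurves.Rank1Residual.X11RankOneCertificates
  Summit.BirchSwinnertonDyer.BirchSwinnertonDyer.Rank1Residual.IntModel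
  Summit.BirchSwinnertonDyer.BirchSwinnertonDyer.Rank1Residual.X11RankOne
  Summit.BirchSwinnertonDyer.Rank1Residual.X11b
  Summit.BirchSwinnertonDyer.Rank1Residual.Additive
  Summit.BirchSwinnertonDyer.Rank1Residual.Supersingular.KuriharaTwist

namespace Summit.BirchSwinnertonDyer.Rank1Residual.Supersingular

/-! ### §1 Class form -/

/-- **N4 TAM-DEFECT, class form, STANDARD CURRENCY — `BSD(E,p)` on X6 ∧ `r_an = 0` ∧ `p ≥ 5` from a LANDED depth-`k` record
(`CertifiedK`), its `validHasseK` rounding certificate and the engine's `L`-value enclosure**, `k ≤ ord_p ∏c_ℓ + 1`: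
`X6RankZero.bsdp_of_kimLower_of_prop48` with `hδ := CertifiedK.kuriharaNumber_ne_zero_of_LValueBall …` (irreducibility and good
reduction at `p` from `ClassX6`).  Named facts `hKimL`, `h48` PUBLISHED; `hGZK`, `hmod`.  Per pair; NOT a class theorem; nothing booked.
[cite: Kim2022StructureSelmer, Thm. 1.9 (6) (PDF p. 8), §1.4.3 (PDF p. 7) and §1.5.1–1.5.3 (PDF pp. 7–8)] [cite: PerrinRiou2003, Prop. 4.8 (p. 162)]
[cite: MazurTateTeitelbaum1986Invent, §I.8 (8.6)] [cite: CremonaAlgorithms1997, §2.8 (2.8.8) (PDF p. 26)] [cite: Miller2011LMS, Def. 1.1] -/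
theorem X6RankZero.bsdp_of_kimLower_of_prop48_of_certifiedK_of_LValueBall
    (W : WeierstrassCurve ℚ) [W.IsElliptic] [W.IsGloballyMinimal]
    (hKimL : Kim2026.rankZero_le_padicValNat_sha_of_kuriharaNumber_ne_zero)
    (h48 : PerrinRiou2003.prop48_padicValRat_bsd_rank_zero_le)
    (hGZK : rank_eq_analyticRank_of_analyticRank_le_one) (hmod : hasEntireLFunction_rat)
    {rs : List TwistRecordK} (hrs : CertifiedK rs) {r : TwistRecordK} (hr' : r ∈ rs) [Fact r.p.Prime] [NeZero r.n]
    (hν : r.n.primeFactors.card = r.primes.length)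
    (hp5 : 5 ≤ r.p) (hX : ClassX6 W r.p) (hr : W.analyticRank = 0)
    {N : ℕ} [NeZero N] (D : ModularParametrizationData W N) (hc : ¬ (r.p : ℤ) ∣ D.maninConstant)
    (hper : ∃ u : ℚ, ‖(u : ℚ_[r.p])‖ = 1 ∧ W.realPeriodRat = u * plusPeriod D.f)
    (hk : 1 ≤ r.k) (hkt : r.k ≤ padicValNat r.p W.tamagawaProduct + 1)
    (hn : Kato.IsKolyvaginProduct W r.p r.k r.n)
    (hcyc : ∀ (ℓ : ℕ) [Fact ℓ.Prime], ℓ ∣ r.n →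
      Nat.card {P : ((WeierstrassCurve.integralModelInt W).map
          (Int.castRingHom (ZMod ℓ))).toAffine.Point // r.p • P = 0} ≤ r.p)
    {cs : List RoundingCert} (hcs : RoundingCertifiedHasseK r.k cs) {c : RoundingCert} (hcc : c ∈ cs)
    (hcp : c.p = r.p) (hcn : c.n = r.n) (hcden : c.den = r.den) (hcbins : c.bins = r.bins) (hD' : 0 < c.dstar)
    (ψ : (ℓ : ℕ) → (ZMod ℓ)ˣ →* Multiplicative (ZMod (r.p ^ r.k)))
    (hψ : ∀ ℓ ∈ r.n.primeFactors, Function.Surjective (ψ ℓ))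
    (hballL : ∀ (L : ZMod (r.p ^ r.k) → ℂ → ℂ), (∀ j, j ≠ 0 → Differentiable ℂ (L j)) →
      (∀ j, j ≠ 0 → ∀ s : ℂ, 2 < s.re → L j s = twistedLSeries D.f (binChar r.n ψ j)⁻¹ s) →
      ∀ k < r.p ^ r.k, ∃ mid rad : ℝ, rad ≤ (c.radNum : ℝ) / 10 ^ c.radExp ∧
        |mid - ((c.binsStar.getD k 0 : ℤ) : ℝ)| ≤ (c.marNum : ℝ) / 10 ^ c.marExp ∧
        |(c.dstar : ℝ) * ((r.components : ℝ) *
          (((∏ ℓ ∈ r.n.primeFactors, ((W.frobeniusTrace ℓ : ℂ) - 2)) * W.entireLFunction 1 +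
            ∑ j ∈ (Finset.univ : Finset (ZMod (r.p ^ r.k))).erase 0,
              ZMod.stdAddChar (-(j * (k : ZMod (r.p ^ r.k)))) *
                (gaussSum (binChar r.n ψ j) (ZMod.stdAddChar (N := r.n)) * L j 1)).re /
            ((r.p ^ r.k : ℕ) * plusPeriod D.f))) - mid| ≤ rad) :
    BSDp W r.p :=
  X6RankZero.bsdp_of_kimLower_of_prop48 W r.p hKimL h48 hGZK hmod hp5 hX hr D hc hper r.k r.n hk hkt hn hcyc ψ hψ
    (CertifiedK.kuriharaNumber_ne_zero_of_LValueBall hrs hr' hν D.isNewformOf (by omega)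
      (ClassX6.irr W r.p (by omega) hX) hX.1.1 hn hcs hcc hcp hcn hcden hcbins hD' ψ hψ hballL)

/-! ### §2 Literal-equation record shape -/

/-- **N4 TAM-DEFECT RECORD SHAPE, STANDARD CURRENCY — `BSD(E, r.p)` on X6 ∧ `r_an = 0` ∧ `r.p ≥ 5` from the literal equation, a
CYCLIC two-prime level `ℓ₁ℓ₂ = r.n ∈ 𝒩_{r.k}` certified in the kernel, a LANDED `CertifiedK` row `r` + `validHasseK r.k` rounding
certificate `c` + the `L`-value enclosure `hballL`.**  Decidable inputs as in `X6RankZero.bsdp_of_kimLower_of_prop48_of_ainvs` (all in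
terms of `r.p`, `r.k`); REMAINING HYPOTHESES = EXACTLY `hKimL`, `h48` (PUBLISHED), `hGZK`, `hmod`; `r_an = 0`, `r.k ≤ ord_p ∏c + 1`
(Cremona), `D` with `p ∤ c_D`, the period transfer; `ψ` surjective at `ℓ₁, ℓ₂`; `hballL` (with `A = Π(a_ℓ − 2)` as an explicit integer, so that a record's statement needs no instance on the abstract `W`).  Per pair; NOT a class theorem; nothing booked.
[cite: Kim2022StructureSelmer, Thm. 1.9 (6) (PDF p. 8), §1.2.2 (PDF p. 5) and §1.4.3 (PDF p. 7)] [cite: PerrinRiou2003, Prop. 4.8 (p. 162)]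
[cite: SilvermanAEC2009, VII.1 Remark 1.1, VII.5 Prop. 5.1(a) and (b)] [cite: IrelandRosen1990, Prop. 5.1.2 and §8.1]
[cite: MazurTateTeitelbaum1986Invent, §I.8 (8.6)] [cite: Miller2011LMS, Def. 1.1] -/
theorem X6RankZero.bsdp_of_kimLower_of_prop48_of_ainvs_of_certifiedK_of_LValueBall
    (hKimL : Kim2026.rankZero_le_padicValNat_sha_of_kuriharaNumber_ne_zero)
    (h48 : PerrinRiou2003.prop48_padicValRat_bsd_rank_zero_le)
    (hGZK : rank_eq_analyticRank_of_analyticRank_le_one) (hmod : hasEntireLFunction_rat)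
    (a1 a2 a3 a4 a6 : ℤ) (hmin : (⟨a1, a2, a3, a4, a6⟩ : WeierstrassCurve ℚ).IsGloballyMinimal)
    -- the landed depth-`k` record and its rounding certificate
    {rs : List TwistRecordK} (hrs : CertifiedK rs) {r : TwistRecordK} (hr' : r ∈ rs) [Fact r.p.Prime]
    (hν : r.primes.length = 2) (hp5 : 5 ≤ r.p) (hk : 1 ≤ r.k)
    {cs : List RoundingCert} (hcs : RoundingCertifiedHasseK r.k cs) {c : RoundingCert} (hcc : c ∈ cs)
    (hcp : c.p = r.p) (hcn : c.n = r.n) (hcden : c.den = r.den) (hcbins : c.bins = r.bins) (hD' : 0 < c.dstar)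
    -- class X6 at `r.p`
    (hpΔ : ¬ (r.p : ℤ) ∣ discOf [a1, a2, a3, a4, a6]) {np : ℕ} (hcnt : countPoints [a1, a2, a3, a4, a6] r.p = np)
    (hap : (r.p : ℤ) ∣ (r.p : ℤ) + 1 - np) (hgcd : Int.gcd (discOf [a1, a2, a3, a4, a6]) (c4Of [a1, a2, a3, a4, a6]) = 1)
    -- the cyclic level `ℓ₁ℓ₂ = r.n ∈ 𝒩_k`
    (ℓ₁ ℓ₂ : ℕ) [Fact ℓ₁.Prime] [Fact ℓ₂.Prime] (hne : ℓ₁ ≠ ℓ₂) [NeZero r.n] (hrn : ℓ₁ * ℓ₂ = r.n)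
    (hℓ₁p : ℓ₁ ≠ r.p) (hℓ₂p : ℓ₂ ≠ r.p) (hℓ₁2 : ℓ₁ ≠ 2) (hℓ₂2 : ℓ₂ ≠ 2)
    (hℓ₁Δ : ¬ (ℓ₁ : ℤ) ∣ discOf [a1, a2, a3, a4, a6]) (hℓ₂Δ : ¬ (ℓ₂ : ℤ) ∣ discOf [a1, a2, a3, a4, a6])
    (h1₁ : ℓ₁ ≡ 1 [MOD r.p ^ r.k]) (h1₂ : ℓ₂ ≡ 1 [MOD r.p ^ r.k]) {n₁ n₂ : ℕ}
    (hc₁ : countPoints [a1, a2, a3, a4, a6] ℓ₁ = n₁) (hc₂ : countPoints [a1, a2, a3, a4, a6] ℓ₂ = n₂)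
    (hd₁ : r.p ^ r.k ∣ n₁) (hd₂ : r.p ^ r.k ∣ n₂)
    (hcyc₁ : Nat.card {P : (((⟨a1, a2, a3, a4, a6⟩ : WeierstrassCurve ℤ)).map
        (Int.castRingHom (ZMod ℓ₁))).toAffine.Point // r.p • P = 0} ≤ r.p)
    (hcyc₂ : Nat.card {P : (((⟨a1, a2, a3, a4, a6⟩ : WeierstrassCurve ℤ)).map
        (Int.castRingHom (ZMod ℓ₂))).toAffine.Point // r.p • P = 0} ≤ r.p)
    {A : ℤ} (hA : A = ((ℓ₁ : ℤ) + 1 - n₁ - 2) * ((ℓ₂ : ℤ) + 1 - n₂ - 2))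
    -- data binders
    (hr0 : (⟨a1, a2, a3, a4, a6⟩ : WeierstrassCurve ℚ).analyticRank = 0)
    (hkt : r.k ≤ padicValNat r.p (⟨a1, a2, a3, a4, a6⟩ : WeierstrassCurve ℚ).tamagawaProduct + 1)
    {N : ℕ} [NeZero N] (D : ModularParametrizationData (⟨a1, a2, a3, a4, a6⟩ : WeierstrassCurve ℚ) N)
    (hc : ¬ (r.p : ℤ) ∣ D.maninConstant)
    (hper : ∃ u : ℚ, ‖(u : ℚ_[r.p])‖ = 1 ∧
      (⟨a1, a2, a3, a4, a6⟩ : WeierstrassCurve ℚ).realPeriodRat = u * plusPeriod D.f)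
    (ψ : (ℓ : ℕ) → (ZMod ℓ)ˣ →* Multiplicative (ZMod (r.p ^ r.k)))
    (hψ₁ : Function.Surjective (ψ ℓ₁)) (hψ₂ : Function.Surjective (ψ ℓ₂))
    (hballL : ∀ (L : ZMod (r.p ^ r.k) → ℂ → ℂ), (∀ j, j ≠ 0 → Differentiable ℂ (L j)) →
      (∀ j, j ≠ 0 → ∀ s : ℂ, 2 < s.re → L j s = twistedLSeries D.f (binChar r.n ψ j)⁻¹ s) →
      ∀ k < r.p ^ r.k, ∃ mid rad : ℝ, rad ≤ (c.radNum : ℝ) / 10 ^ c.radExp ∧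
        |mid - ((c.binsStar.getD k 0 : ℤ) : ℝ)| ≤ (c.marNum : ℝ) / 10 ^ c.marExp ∧
        |(c.dstar : ℝ) * ((r.components : ℝ) *
          (((A : ℂ) * (⟨a1, a2, a3, a4, a6⟩ : WeierstrassCurve ℚ).entireLFunction 1 +
            ∑ j ∈ (Finset.univ : Finset (ZMod (r.p ^ r.k))).erase 0,
              ZMod.stdAddChar (-(j * (k : ZMod (r.p ^ r.k)))) *
                (gaussSum (binChar r.n ψ j) (ZMod.stdAddChar (N := r.n)) * L j 1)).re /
            ((r.p ^ r.k : ℕ) * plusPeriod D.f))) - mid| ≤ rad) :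
    BSDp (⟨a1, a2, a3, a4, a6⟩ : WeierstrassCurve ℚ) r.p := by
  have h0 : discOf [a1, a2, a3, a4, a6] ≠ 0 := fun h ↦ hpΔ (by rw [h]; exact dvd_zero _)
  haveI := isElliptic_of_discOf_ne_zero a1 a2 a3 a4 a6 h0
  haveI := hmin
  have hp2 : r.p ≠ 2 := by omega
  have hI : integralModelInt (⟨a1, a2, a3, a4, a6⟩ : WeierstrassCurve ℚ) = ⟨a1, a2, a3, a4, a6⟩ :=
    integralModelInt_eq_of_map_eq _ (map_mk_int a1 a2 a3 a4 a6)
  have hN₁ := natCard_point_eq_of_countPoints a1 a2 a3 a4 a6 ℓ₁ hℓ₁2 hℓ₁Δ hc₁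
  have hN₂ := natCard_point_eq_of_countPoints a1 a2 a3 a4 a6 ℓ₂ hℓ₂2 hℓ₂Δ hc₂
  have hX : ClassX6 (⟨a1, a2, a3, a4, a6⟩ : WeierstrassCurve ℚ) r.p :=
    classX6_of_intModel r.p hp5 hI (by rw [intCurve_Δ]; exact hpΔ)
      (natCard_point_eq_of_countPoints a1 a2 a3 a4 a6 r.p hp2 hpΔ hcnt) hap
      (by rw [intCurve_Δ, intCurve_c₄]; exact hgcd)
  have hK₁ : Kato.IsKolyvaginPrime (⟨a1, a2, a3, a4, a6⟩ : WeierstrassCurve ℚ) r.p r.k ℓ₁ :=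
    Additive.isKolyvaginPrime_of_intModel_of_card hI r.p r.k ℓ₁ hℓ₁p (by rw [intCurve_Δ]; exact hℓ₁Δ) h1₁ hN₁ hd₁
  have hK₂ : Kato.IsKolyvaginPrime (⟨a1, a2, a3, a4, a6⟩ : WeierstrassCurve ℚ) r.p r.k ℓ₂ :=
    Additive.isKolyvaginPrime_of_intModel_of_card hI r.p r.k ℓ₂ hℓ₂p (by rw [intCurve_Δ]; exact hℓ₂Δ) h1₂ hN₂ hd₂
  have hn : Kato.IsKolyvaginProduct (⟨a1, a2, a3, a4, a6⟩ : WeierstrassCurve ℚ) r.p r.k r.n := by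
    rw [← hrn]; exact Additive.isKolyvaginProduct_mul hK₁ hK₂ hne
  have hν' : r.n.primeFactors.card = r.primes.length := by
    rw [← hrn, hν, Nat.primeFactors_mul (Fact.out : ℓ₁.Prime).ne_zero (Fact.out : ℓ₂.Prime).ne_zero,
      (Fact.out : ℓ₁.Prime).primeFactors, (Fact.out : ℓ₂.Prime).primeFactors,
      show ({ℓ₁} ∪ {ℓ₂} : Finset ℕ) = {ℓ₁, ℓ₂} from rfl, Finset.card_pair hne]
  have hcyc : ∀ (ℓ : ℕ) [Fact ℓ.Prime], ℓ ∣ r.n →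
      Nat.card {P : ((WeierstrassCurve.integralModelInt (⟨a1, a2, a3, a4, a6⟩ : WeierstrassCurve ℚ)).map
          (Int.castRingHom (ZMod ℓ))).toAffine.Point // r.p • P = 0} ≤ r.p := by
    rw [hI]
    exact forall_card_torsion_le_of_level ⟨a1, a2, a3, a4, a6⟩ r.p r.n ℓ₁ ℓ₂ hrn.symm hcyc₁ hcyc₂
  have hψ : ∀ ℓ ∈ r.n.primeFactors, Function.Surjective (ψ ℓ) := by
    rw [← hrn]; exact surjective_family_of_mem_primeFactors_mul Fact.out Fact.out ψ hψ₁ hψ₂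
  have hprod : (∏ ℓ ∈ r.n.primeFactors,
      (((⟨a1, a2, a3, a4, a6⟩ : WeierstrassCurve ℚ).frobeniusTrace ℓ : ℂ) - 2)) = (A : ℂ) := by
    rw [← hrn]; exact prod_primeFactors_frobeniusTrace_sub_two_eq hI Fact.out Fact.out hne hN₁ hN₂ hA
  refine X6RankZero.bsdp_of_kimLower_of_prop48_of_certifiedK_of_LValueBall _ hKimL h48 hGZK hmod hrs hr' hν' hp5 hX hr0 D hc
    hper hk hkt hn hcyc hcs hcc hcp hcn hcden hcbins hD' ψ hψ ?_
  intro L hL hL' k hk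
  obtain ⟨mid, rad, h1, h2, h3⟩ := hballL L hL hL' k hk
  refine ⟨mid, rad, h1, h2, ?_⟩
  rw [hprod]
  exact h3

end Summit.BirchSwinnertonDyer.Rank1Residual.Supersingular

end
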